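import Mathlib
import Summits.Ventures.PercRepro2.TypedResidualCore
import Summits.Ventures.PercRepro2.TypedSupportRestrict
import Summits.Ventures.PercRepro2.TypedTwoTerminal

/-!
# The two-terminal rule as a LAYER of the reduction spine (blind cell PercRepro2, p2 g3,
2026-08-25; mine-1 §26(e), the lead's ruling INBOX 3863 (2) / 10:22Z)

A **two-terminal part** of a typed graph: a set `I` of unmarked vertices and two terminals `s, t ∉ I`
with a typed edge set `L ⊆ F` of at least two edges, every edge of `L` inside `I ∪ {s, t}`, and no
other typed edge at a vertex of `I` (`TwoTerminalPart`, `HasTwoTerminalPart`). By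
`typedCount_twoTerminal` such an instance is a nonnegative integer combination of instances with
FEWER typed edges, so row 2′TRI on the core instances WITHOUT a two-terminal part
(`ResidualCoreT := ResidualCore ∧ ¬ HasTwoTerminalPart`) gives it on every core instance
(`residualCore_all_of_residualCoreT_all`, a strong induction on the number of typed edges through
the bounded spine `typedCount_nonneg_of_residualR_card_le`), hence the crux of record:
**`HCov_all_of_residualCoreT_all : ResidualCoreT_all R → HCov_all R`** (unconditional).
The layers above the core (hats, root cuts, stars) compose on top as before.
-/

namespace Summit.Ventures.PercRepro2

namespace CovForm

namespace TypedRed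

open TwoTerm Restrict

section Part

variable {V : Type*} {E : Type*} [DecidableEq E]

/-- A two-terminal part: internal unmarked vertices `I`, terminals `s, t`, typed edges `L` (at least
two) inside `I ∪ {s, t}`, no other typed edge at a vertex of `I`. -/
structure TwoTerminalPart (ends : E → Sym2 V) (o a₁ a₂ a₃ b : V) (F : Finset E) (I : Set V)
    (s t : V) (L : Finset E) : Prop where
  s_ext : s ∉ I
  t_ext : t ∉ I
  unmarked : ∀ v ∈ I, v ≠ o ∧ v ≠ a₁ ∧ v ≠ a₂ ∧ v ≠ a₃ ∧ v ≠ b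
  sub : L ⊆ F
  two_le : 2 ≤ L.card
  ends_in : ∀ e ∈ L, ∀ v ∈ ends e, v ∈ I ∨ v = s ∨ v = t
  closed : ∀ e, e ∉ L → (∃ v ∈ I, v ∈ ends e) → e ∉ F

/-- The typed graph contains a two-terminal part. -/
def HasTwoTerminalPart (ends : E → Sym2 V) (o a₁ a₂ a₃ b : V) (F : Finset E) : Prop :=
  ∃ (I : Set V) (s t : V) (L : Finset E), TwoTerminalPart ends o a₁ a₂ a₃ b F I s t L

end Part

section Core

variable {V : Type*} {E : Type*} [DecidableEq V] [Fintype E] [DecidableEq E]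

/-- **The core without two-terminal parts.** -/
structure ResidualCoreT (ends : E → Sym2 V) (o a₁ a₂ a₃ b : V) (F : Finset E) : Prop where
  core : ResidualCore ends o a₁ a₂ a₃ b F
  no_twoTerminal : ¬ HasTwoTerminalPart ends o a₁ a₂ a₃ b F

end Core

section Closure

variable (R : Type*) [Field R] [LinearOrder R] [IsStrictOrderedRing R]

/-- **Row 2′TRI on `ResidualCoreT`, over every finite graph.** -/
def ResidualCoreT_all : Prop :=
  ∀ (V E : Type) [Fintype V] [DecidableEq V] [Fintype E] [DecidableEq E]
    (ends : E → Sym2 V) (o a₁ a₂ a₃ b : V) (F : Finset E) (τ : E → ℕ),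
    (∀ e ∈ F, τ e = 1 ∨ τ e = 2) → ResidualCoreT ends o a₁ a₂ a₃ b F →
      0 ≤ typedCount F (fun _ => false) τ
        (K3 ends o a₁ a₂ a₃ b : Config E → Config E → Config E → R)

/-- The support of an instance pinned closed everywhere is its typed set. -/
lemma support_false {E : Type*} [Fintype E] [DecidableEq E] (F : Finset E) :
    support F (fun _ => false) = F := by
  ext e
  simp [mem_support]

/-- The support of an instance pinned closed except at one edge. -/
lemma support_update_true {E : Type*} [Fintype E] [DecidableEq E] (F : Finset E) (h₀ : E) :
    support F (Function.update (fun _ => false) h₀ true) = insert h₀ F := by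
  ext e
  rw [mem_support, Finset.mem_insert]
  by_cases h : e = h₀
  · subst h; simp
  · simp [h]

/-- **(TRI) on the core from (TRI) on the core without two-terminal parts** — by strong induction on
the number of typed edges: a core instance with a two-terminal part is a nonnegative integer
combination of instances with fewer typed edges (`typedCount_twoTerminal`), and those are handled
by the bounded spine, the separated / root-bridge / coincidence theorems and the induction
hypothesis. -/
theorem residualCore_all_of_residualCoreT_all (hc : ResidualCoreT_all R) : ResidualCore_all R := by
  suffices h : ∀ N : ℕ, ∀ (V E : Type) [Fintype V] [DecidableEq V] [Fintype E] [DecidableEq E]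
      (ends : E → Sym2 V) (o a₁ a₂ a₃ b : V) (F : Finset E) (τ : E → ℕ),
      (∀ e ∈ F, τ e = 1 ∨ τ e = 2) → ResidualCore ends o a₁ a₂ a₃ b F → F.card ≤ N →
        0 ≤ typedCount F (fun _ => false) τ
          (K3 ends o a₁ a₂ a₃ b : Config E → Config E → Config E → R) by
    intro V E _ _ _ _ ends o a₁ a₂ a₃ b F τ hτ hres
    exact h F.card V E ends o a₁ a₂ a₃ b F τ hτ hres le_rfl
  intro N
  induction N using Nat.strong_induction_on with
  | _ N ih =>
  intro V E _ _ _ _ ends o a₁ a₂ a₃ b F τ hτ hres hN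
  by_cases hT : HasTwoTerminalPart ends o a₁ a₂ a₃ b F
  · obtain ⟨I, s, t, L, hP⟩ := hT
    obtain ⟨h₀, h₀L⟩ : ∃ h₀, h₀ ∈ L := Finset.card_pos.1 (by have := hP.two_le; omega)
    have hLF := Finset.card_le_card hP.sub
    have hN1 : N - 1 < N := by have := hP.two_le; omega
    -- the bounded spine at `N - 1`: every residual instance with at most `N - 1` typed edges
    have tower : ∀ (E' : Type) [Fintype E'] [DecidableEq E'] (ends' : E' → Sym2 V)
        (o' a₁' a₂' a₃' b' : V) (F' : Finset E') (τ' : E' → ℕ), (∀ e ∈ F', τ' e = 1 ∨ τ' e = 2) →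
        ResidualR ends' o' a₁' a₂' a₃' b' F' → F'.card ≤ N - 1 →
          0 ≤ typedCount F' (fun _ => false) τ'
            (K3 ends' o' a₁' a₂' a₃' b' : Config E' → Config E' → Config E' → R) := by
      intro E' _ _ ends' o' a₁' a₂' a₃' b' F' τ' hτ' hR hcard
      by_cases hcon : Conn ends' (typedConfig F') a₁' a₂'
      · by_cases hbr : RootBridge.HasRootBridgeSameSide' ends' o' a₁' a₂' b' F'
        · exact RootBridge.typedCount_nonneg_of_hasRootBridgeSameSide' ends' o' a₁' a₂' a₃' b' F'
            τ' hτ' hbr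
        by_cases hm : MarksDistinct o' a₁' a₂' a₃' b'
        · exact ih (N - 1) hN1 V E' ends' o' a₁' a₂' a₃' b' F' τ' hτ'
            ⟨⟨⟨hR.residual, hcon⟩, hR.root_reach⟩, hbr, hm⟩ hcard
        · rw [typedCount_eq_zero_of_not_marksDistinct ends' hm]
      · exact Separated.typedCount_nonneg_of_typedConfig_sep ends' o' a₁' a₂' a₃' b' F' τ' hτ' hcon
    have hz0 : offL L (fun _ : E => false) = fun _ => false := by
      funext e; simp [offL]
    refine typedCount_nonneg_of_twoTerminal ends o a₁ a₂ a₃ b hP.s_ext hP.t_ext hP.unmarked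
      hP.ends_in h₀L hP.sub _ τ (fun e he hv => ⟨hP.closed e he hv, rfl⟩) ?_
    intro k hk
    rw [hz0]
    have hh₀ : h₀ ∉ F \ L := fun h => (Finset.mem_sdiff.1 h).2 h₀L
    have hcardFL : (F \ L).card = F.card - L.card := Finset.card_sdiff_of_subset hP.sub
    have hmixed : ∀ e ∈ F \ L, Function.update τ h₀ k e = 1 ∨ Function.update τ h₀ k e = 2 := by
      intro e he
      rw [Function.update_of_ne (fun h => hh₀ (by rw [← h]; exact he))]
      exact hτ e (Finset.mem_sdiff.1 he).1
    rcases Nat.lt_or_ge k 3 with hk3 | hk3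
    · rcases Nat.eq_zero_or_pos k with hk0 | hk0
      · -- type `0`: the edge is deleted
        subst hk0
        rw [typedCount_type_zero (insert h₀ (F \ L)) h₀ (Finset.mem_insert_self _ _)
          (fun _ => false) (Function.update τ h₀ 0) (Function.update_self h₀ 0 τ)
          (K3 (Function.update ends h₀ s(s, t)) o a₁ a₂ a₃ b), Finset.erase_insert hh₀]
        have hz' : Function.update (fun _ : E => false) h₀ false = fun _ => false := by
          funext e; by_cases h : e = h₀ <;> simp [h]
        rw [hz']
        refine typedCount_nonneg_of_residualR_card_le (N - 1) tower
          (Function.update ends h₀ s(s, t)) o a₁ a₂ a₃ b (F \ L)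
          _ _ hmixed ?_
        rw [support_false, hcardFL]
        have := hP.two_le
        omega
      · -- mixed types `1`, `2`: the bounded spine directly
        refine typedCount_nonneg_of_residualR_card_le (N - 1) tower
          (Function.update ends h₀ s(s, t)) o a₁ a₂ a₃ b
          (insert h₀ (F \ L)) _ _ ?_ ?_
        · intro e he
          rcases Finset.mem_insert.1 he with rfl | he
          · rw [Function.update_self]; omega
          · exact hmixed e he
        · rw [support_false, Finset.card_insert_of_notMem hh₀, hcardFL]
          have := hP.two_le
          omega
    · -- type `3`: the edge is pinned open
      have hk3' : k = 3 := by omega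
      subst hk3'
      rw [typedCount_type_three (insert h₀ (F \ L)) h₀ (Finset.mem_insert_self _ _)
        (fun _ => false) (Function.update τ h₀ 3) (Function.update_self h₀ 3 τ)
        (K3 (Function.update ends h₀ s(s, t)) o a₁ a₂ a₃ b), Finset.erase_insert hh₀]
      refine typedCount_nonneg_of_residualR_card_le (N - 1) tower
          (Function.update ends h₀ s(s, t)) o a₁ a₂ a₃ b (F \ L)
        _ _ hmixed ?_
      rw [support_update_true, Finset.card_insert_of_notMem hh₀, hcardFL]
      have := hP.two_le
      omega
  · exact hc V E ends o a₁ a₂ a₃ b F τ hτ ⟨hres, hT⟩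

/-- **THE CRUX OF RECORD FROM (TRI) ON THE CORE WITHOUT TWO-TERMINAL PARTS** (unconditional). -/
theorem HCov_all_of_residualCoreT_all (hc : ResidualCoreT_all R) : HCov_all R :=
  HCov_all_of_residualCore_all R (residualCore_all_of_residualCoreT_all R hc)

end Closure

end TypedRed

end CovForm

end Summit.Ventures.PercRepro2
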